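import Summits.QuantumFields.BalabanUV.T4Continuum.Support.DirichletTubeBlock
import Summits.QuantumFields.BalabanUV.T4Continuum.Support.DirichletVertexCubes
import Summits.QuantumFields.BalabanUV.T4Continuum.Support.LongitudinalRamp

/-!
# `BalabanUV.T4Continuum.Support.DirichletTubeEnergy` — NE2 (node U1a) formalisation swarm, sub-row `T4-U1a.S-NE2-D1-DIRICHLET°`, supplier item
# «Δ1-TUBES» (file T2): THE TRANSVERSAL ENERGY NEAR AN EDGE DECAYS, ONE TUBE — for a field `z` supported in a block region `blockReg S` of the fine
# torus (`M : Fin (d+1) → ℕ`, longitudinal axis `λ`, `d ≥ 2` transversal directions), a transversal vertex `β′` with an exterior transversal octant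
# `σ` ALONG THE WHOLE ZONE of a longitudinal lattice ramp (`insertNth λ (blk1 t) (cornerBlock β′ σ) ∉ S`, `t ∈ zoneL t₀`), gen 6's
# `tube_decay_ramp` read in energy units and combined with file 14 slice by slice: the transversal energy of `z` within `r` of the edge
# `{transversal coordinates = vertex β′} × plateau` is at most `θ_d^J` times the zone budget of the big transversal cubes
# (unit b2b-balaban-t4-ne2-formalise-leaf-08, gen 7, file T2)

HONEST FRAMING.  Rung (B)+1 estimate at MODEL level (one lattice field, finite torus); [folklore] lattice De Giorgi–Widman on tubes; NE2 (U1a)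
is NOT proved by this file; spine PROVED 0/9 unchanged; NOT infinite volume, NOT the mass gap, NOT Clay.  HONEST DEPENDENCY (verbatim):
«continuum YM on T⁴ ⇐ BetaPertH ∧ nine spine estimates (0/9 proved); BetaPertH ⇐ (D1) ∧ (D4) ∧ CAP+tail; G-an2-4 gates asym, D1 and NE2/3/4.»

WHAT THIS FILE PROVES (0 sorry; `LongitudinalRamp.tube_decay_ramp`, `DirichletVertexCubes.sum_nearVtx_le_dirOn`, file T1 BY NAME).
`plateau` (data: the longitudinal plateau positions), `sum_weight_le_sum_zone`, `tube_decay_energy` (the tube decay in energy units with the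
zone budgets), `sum_plateau_le_sum_weight`, and the END **`near_edge_energy_le`**.

ABSOLUTE RULE (cell, verbatim): «No internally-minted statement may enter as a cited fact. Every hypothesis is either kernel-proved in
this package or a verbatim quotation of a PUBLISHED theorem with page reference. The manuscript(s) under audit are NOT citable for
their own disputed steps — they are the thing under adjudication; programme-internal (2001/route/tribunal) claims are never citable.»
[folklore]; one data definition; no `def … : Prop` fact.  NOT CLAIMED: the sum over tubes, the cover, NE2, NE3.
-/

noncomputable section

open scoped BigOperators ComplexConjugate Matrix
open Finset

namespace Summit.QuantumFields.BalabanUV.T4Continuum.DirichletTubeEnergy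

open Literature.MathematicalPhysics.QuantumFieldTheory.Balaban1983to89.B5Prop11Plancherel (Tor fine)
open Literature.MathematicalPhysics.QuantumFieldTheory.Balaban1983to89.B5Action121 (sdiff LapS)
open Summit.QuantumFields.BalabanUV.Beta.GAN24.DirichletBoxTrace (blockReg)
open Summit.QuantumFields.BalabanUV.T4Continuum.DirichletDirectionalBesov (restrictTo)
open Summit.QuantumFields.BalabanUV.T4Continuum.CoordSlabPoincare (dirOn dirOn_nonneg)
open Summit.QuantumFields.BalabanUV.T4Continuum.CoordOctantBoxes (oct)
open Summit.QuantumFields.BalabanUV.T4Continuum.DirichletHoleFillingCutoff (chart)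
open Summit.QuantumFields.BalabanUV.T4Continuum.DirichletHoleFilling (theta theta_lt_one)
open Summit.QuantumFields.BalabanUV.T4Continuum.DirichletMorreyDecay (shift)
open Summit.QuantumFields.BalabanUV.T4Continuum.DirichletMorreyDecayBlock (cornerBase cornerBlock vanish_oct_of_blockReg)
open Summit.QuantumFields.BalabanUV.T4Continuum.DirichletVertexCubes (NearVtx vtxBase sum_nearVtx_le_dirOn)
open Summit.QuantumFields.BalabanUV.T4Continuum.TorusSlicing (Nsl ins zsl sdiff_succAbove_ins)
open Summit.QuantumFields.BalabanUV.T4Continuum.LongitudinalRamp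
  (lchart phiL zoneL lchart_injective phiL_nonneg phiL_le_one mem_zone_of_phiL_ne_zero phiL_eq_one tube_decay_ramp)
open Summit.QuantumFields.BalabanUV.T4Continuum.DirichletTubeBlock (Msl blk1 Ssl zsl_support)

variable {d : ℕ} (n : ℕ) [NeZero n] (M : Fin (d + 1) → ℕ) [hM : ∀ μ, NeZero (M μ)] (lam : Fin (d + 1))

/-- the longitudinal PLATEAU of the ramp zone starting at `t₀`: the chart positions `s` with `k_L ≤ s + 1`, `s ≤ 3k_L` (where `phiL = 1`). [folklore] -/
def plateau (kL : ℕ) {nL : ℕ} (t₀ : ZMod (fine n M lam)) : Finset (ZMod (fine n M lam)) :=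
  (univ.filter fun s : Fin (nL + 1) => kL ≤ (s : ℕ) + 1 ∧ (s : ℕ) ≤ 3 * kL).image (lchart (fine n M) lam (nL := nL) t₀)

section Tube

variable {n M lam}
variable {kL nL : ℕ} (hkL : 2 ≤ kL) (hnL : 4 * kL = nL + 1) (hfit : nL + 1 ≤ fine n M lam) (t₀ : ZMod (fine n M lam))
include hkL hnL hfit

/-- a `phiL²`-weighted sum of non-negative terms is at most the plain sum over the zone. [folklore] -/
theorem sum_weight_le_sum_zone {X : ZMod (fine n M lam) → ℝ} (hX : ∀ t, 0 ≤ X t) :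
    ∑ t, phiL (fine n M) lam kL (nL := nL) t₀ t ^ 2 * X t ≤ ∑ t ∈ zoneL (fine n M) lam (nL := nL) t₀, X t := by
  classical
  have hle : ∀ t, phiL (fine n M) lam kL (nL := nL) t₀ t ^ 2 * X t ≤ (if t ∈ zoneL (fine n M) lam (nL := nL) t₀ then X t else 0) := by
    intro t
    by_cases ht : t ∈ zoneL (fine n M) lam (nL := nL) t₀
    · rw [if_pos ht]
      have h1 := phiL_le_one (fine n M) lam kL t₀ hfit t
      have h0 := phiL_nonneg (fine n M) lam kL t₀ hkL hnL t
      have : phiL (fine n M) lam kL (nL := nL) t₀ t ^ 2 ≤ 1 := by nlinarith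
      nlinarith [hX t]
    · have h0 : phiL (fine n M) lam kL (nL := nL) t₀ t = 0 := by
        by_contra h; exact ht (mem_zone_of_phiL_ne_zero (fine n M) lam kL t₀ h)
      rw [if_neg ht, h0]; simp
  refine (Finset.sum_le_sum fun t _ => hle t).trans (le_of_eq ?_)
  rw [← Finset.sum_filter, Finset.filter_mem_eq_inter, Finset.univ_inter]

omit hnL in
/-- a sum over the plateau of non-negative terms is at most the `phiL²`-weighted sum. [folklore] -/
theorem sum_plateau_le_sum_weight {X : ZMod (fine n M lam) → ℝ} (hX : ∀ t, 0 ≤ X t) :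
    ∑ t ∈ plateau n M lam kL (nL := nL) t₀, X t ≤ ∑ t, phiL (fine n M) lam kL (nL := nL) t₀ t ^ 2 * X t := by
  classical
  rw [← Finset.sum_filter_add_sum_filter_not univ (fun t => t ∈ plateau n M lam kL (nL := nL) t₀)]
  rw [Finset.filter_mem_eq_inter, Finset.univ_inter]
  have h2 : 0 ≤ ∑ t ∈ univ.filter (fun t => ¬ t ∈ plateau n M lam kL (nL := nL) t₀), phiL (fine n M) lam kL (nL := nL) t₀ t ^ 2 * X t :=
    Finset.sum_nonneg fun t _ => mul_nonneg (sq_nonneg _) (hX t)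
  have h1 : ∑ t ∈ plateau n M lam kL (nL := nL) t₀, X t = ∑ t ∈ plateau n M lam kL (nL := nL) t₀, phiL (fine n M) lam kL (nL := nL) t₀ t ^ 2 * X t := by
    refine Finset.sum_congr rfl fun t ht => ?_
    rw [plateau, mem_image] at ht
    obtain ⟨s, hs, rfl⟩ := ht
    rw [mem_filter] at hs
    rw [phiL_eq_one (fine n M) lam kL t₀ hkL hfit hs.2.1 hs.2.2, one_pow, one_mul]
  linarith

variable (hd : 2 ≤ d) (S : Tor M → Prop) [DecidablePred S] {z : Tor (fine n M) → ℂ} (hz : ∀ x, ¬ blockReg n M S x → z x = 0)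
  (β' : Tor (Msl M lam)) (σ : Fin d → Bool)
  (hext : ∀ t ∈ zoneL (fine n M) lam (nL := nL) t₀, ¬ S (Fin.insertNth lam (blk1 n M lam t) (cornerBlock (Msl M lam) β' σ)))
  {m : ℕ} (hm : 1 ≤ m) {n₀ : ℕ} (hn₀ : 4 * m = n₀ + 1) (J : ℕ) {nn : ℕ} (hnn : 4 * (2 ^ J * m) = nn + 1) (hK : 2 * (2 ^ J * m) ≤ n)
  (hN' : ∀ ν, nn + 1 ≤ fine n (Msl M lam) ν)
include hd hz hext hm hn₀ hnn hK hN'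

/-- **TUBE DECAY IN ENERGY UNITS WITH ZONE BUDGETS**:
`Σ_t φ(t)²·n²·dirOn(zsl t ∘ chart small) ≤ θ^J·((1 + 64(1+2^d)K²·4ℓ²)·Σ_{t∈zone} n²·dirOn(zsl t ∘ chart big) + 64(1+2^d)K²/n²·Σ_{t∈zone}Σ_j ‖(1_ΩΔz)(ins t (chart big j))‖²)`,
`ℓ = 1/(k_L − 1)`, small cube `vtxBase m K β′`, big cube `cornerBase β′ K`, `K = 2^J m`. [folklore] -/
theorem tube_decay_energy :
    ∑ t, phiL (fine n M) lam kL (nL := nL) t₀ t ^ 2 * ((n : ℝ) ^ 2 * dirOn (univ : Finset (Fin d → Fin (n₀ + 1)))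
        (zsl (fine n M) lam z t ∘ chart (fine n (Msl M lam)) (n := n₀) (vtxBase n (Msl M lam) m (2 ^ J * m) β')))
      ≤ theta d ^ J * ((1 + (64 * (1 + 2 ^ d) * (((2 ^ J * m : ℕ) : ℝ)) ^ 2) * (4 * (1 / ((kL : ℝ) - 1)) ^ 2))
            * ∑ t ∈ zoneL (fine n M) lam (nL := nL) t₀, (n : ℝ) ^ 2 * dirOn (univ : Finset (Fin d → Fin (nn + 1)))
                (zsl (fine n M) lam z t ∘ chart (fine n (Msl M lam)) (n := nn) (cornerBase n (Msl M lam) β' (2 ^ J * m)))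
          + 64 * (1 + 2 ^ d) * (((2 ^ J * m : ℕ) : ℝ)) ^ 2 / (n : ℝ) ^ 2
            * ∑ t ∈ zoneL (fine n M) lam (nL := nL) t₀, ∑ j : Fin d → Fin (nn + 1),
                ‖restrictTo (blockReg n M S) (LapS (fine n M) (n : ℂ) *ᵥ z) (ins (fine n M) lam t (chart (fine n (Msl M lam)) (cornerBase n (Msl M lam) β' (2 ^ J * m)) j))‖ ^ 2) := by
  have hnpos : (0 : ℝ) < n := by exact_mod_cast Nat.pos_of_ne_zero (NeZero.ne n)
  have hc : (n : ℂ) ≠ 0 := by exact_mod_cast NeZero.ne n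
  have hθ : 0 ≤ theta d ^ J := pow_nonneg (by linarith [(theta_lt_one d).1]) J
  -- vanishing of the slices on the transversal chart octant along the zone
  have hvan : ∀ t ∈ zoneL (fine n M) lam (nL := nL) t₀, ∀ j ∈ oct (n := nn) (2 ^ J * m) σ,
      zsl (fine n M) lam z t (chart (Nsl (fine n M) lam) (cornerBase n (Msl M lam) β' (2 ^ J * m)) j) = 0 :=
    fun t ht j hj => vanish_oct_of_blockReg n (Msl M lam) (Ssl M lam S (blk1 n M lam t)) (zsl_support n M lam S hz t) β' σ
      (hext t ht) hK hnn j hj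
  have hdec := tube_decay_ramp (fine n M) lam kL t₀ hd hc hz σ hkL hnL hfit hm hn₀ J hnn hN' (cornerBase n (Msl M lam) β' (2 ^ J * m)) hvan
  rw [Nat.mul_assoc, Complex.norm_natCast] at hdec
  -- abbreviations (all on the transversal fine torus `fine n (Msl M λ)`, definitionally gen 6's `Nsl (fine n M) λ`)
  set Φ : ZMod (fine n M lam) → ℝ := fun t => phiL (fine n M) lam kL (nL := nL) t₀ t ^ 2 with hΦ
  set Ps : ZMod (fine n M lam) → ℝ := fun t => dirOn (univ : Finset (Fin d → Fin (n₀ + 1)))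
    (zsl (fine n M) lam z t ∘ chart (fine n (Msl M lam)) (n := n₀) (vtxBase n (Msl M lam) m (2 ^ J * m) β')) with hPs
  set P : ZMod (fine n M lam) → ℝ := fun t => dirOn (univ : Finset (Fin d → Fin (nn + 1)))
    (zsl (fine n M) lam z t ∘ chart (fine n (Msl M lam)) (n := nn) (cornerBase n (Msl M lam) β' (2 ^ J * m))) with hP
  set Q : ZMod (fine n M lam) → ℝ := fun t => ∑ j : Fin d → Fin (nn + 1),
    ‖restrictTo (blockReg n M S) (LapS (fine n M) (n : ℂ) *ᵥ z)
      (ins (fine n M) lam t (chart (fine n (Msl M lam)) (cornerBase n (Msl M lam) β' (2 ^ J * m)) j))‖ ^ 2 with hQ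
  set Kc : ℝ := 64 * (1 + 2 ^ d) * (((2 ^ J * m : ℕ) : ℝ)) ^ 2 with hKc
  set ell2 : ℝ := 4 * (1 / ((kL : ℝ) - 1)) ^ 2 with hell2
  have hdec' : ∑ t, Φ t * Ps t ≤ theta d ^ J * (∑ t, Φ t * P t + Kc * ((∑ t, Φ t * Q t) / (n : ℝ) ^ 4
      + ell2 * ∑ t ∈ zoneL (fine n M) lam (nL := nL) t₀, P t)) := hdec
  have hP0 : ∀ t, 0 ≤ P t := fun t => dirOn_nonneg _ _
  have hQ0 : ∀ t, 0 ≤ Q t := fun t => Finset.sum_nonneg fun _ _ => sq_nonneg _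
  have hA := sum_weight_le_sum_zone hkL hnL hfit t₀ hP0
  have hB := sum_weight_le_sum_zone hkL hnL hfit t₀ hQ0
  have hKc0 : 0 ≤ Kc := by rw [hKc]; positivity
  have hell0 : 0 ≤ ell2 := by rw [hell2]; positivity
  have hn4 : (0 : ℝ) < (n : ℝ) ^ 4 := by positivity
  have step1 : ∑ t, Φ t * P t + Kc * ((∑ t, Φ t * Q t) / (n : ℝ) ^ 4 + ell2 * ∑ t ∈ zoneL (fine n M) lam (nL := nL) t₀, P t)
      ≤ (1 + Kc * ell2) * ∑ t ∈ zoneL (fine n M) lam (nL := nL) t₀, P t + Kc * ((∑ t ∈ zoneL (fine n M) lam (nL := nL) t₀, Q t) / (n : ℝ) ^ 4) := by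
    have h1 : Kc * ((∑ t, Φ t * Q t) / (n : ℝ) ^ 4) ≤ Kc * ((∑ t ∈ zoneL (fine n M) lam (nL := nL) t₀, Q t) / (n : ℝ) ^ 4) :=
      mul_le_mul_of_nonneg_left (div_le_div_of_nonneg_right hB hn4.le) hKc0
    have e : Kc * ((∑ t, Φ t * Q t) / (n : ℝ) ^ 4 + ell2 * ∑ t ∈ zoneL (fine n M) lam (nL := nL) t₀, P t)
        = Kc * ((∑ t, Φ t * Q t) / (n : ℝ) ^ 4) + Kc * ell2 * ∑ t ∈ zoneL (fine n M) lam (nL := nL) t₀, P t := by ring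
    rw [e]
    linarith [hA, h1]
  have step3 := hdec'.trans (mul_le_mul_of_nonneg_left step1 hθ)
  have step4 := mul_le_mul_of_nonneg_left step3 (sq_nonneg (n : ℝ))
  have eL : ∑ t, Φ t * ((n : ℝ) ^ 2 * Ps t) = (n : ℝ) ^ 2 * ∑ t, Φ t * Ps t := by
    rw [Finset.mul_sum]; exact Finset.sum_congr rfl fun t _ => by ring
  have eR : theta d ^ J * ((1 + Kc * ell2) * ∑ t ∈ zoneL (fine n M) lam (nL := nL) t₀, (n : ℝ) ^ 2 * P t
        + Kc / (n : ℝ) ^ 2 * ∑ t ∈ zoneL (fine n M) lam (nL := nL) t₀, Q t)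
      = (n : ℝ) ^ 2 * (theta d ^ J * ((1 + Kc * ell2) * ∑ t ∈ zoneL (fine n M) lam (nL := nL) t₀, P t
        + Kc * ((∑ t ∈ zoneL (fine n M) lam (nL := nL) t₀, Q t) / (n : ℝ) ^ 4))) := by
    rw [← Finset.mul_sum]; field_simp; try ring
  rw [eL, eR]
  exact step4

end Tube

/-! ## The END: the transversal energy near the edge, on the plateau -/

section End

variable {n M lam}
variable {kL nL : ℕ} (hkL : 2 ≤ kL) (hnL : 4 * kL = nL + 1) (hfit : nL + 1 ≤ fine n M lam) (t₀ : ZMod (fine n M lam))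
  (hd : 2 ≤ d) (S : Tor M → Prop) [DecidablePred S] {z : Tor (fine n M) → ℂ} (hz : ∀ x, ¬ blockReg n M S x → z x = 0)
  (β' : Tor (Msl M lam)) (σ : Fin d → Bool)
  (hext : ∀ t ∈ zoneL (fine n M) lam (nL := nL) t₀, ¬ S (Fin.insertNth lam (blk1 n M lam t) (cornerBlock (Msl M lam) β' σ)))
  {m : ℕ} (h4m : 4 * m ≤ n) {n₀ : ℕ} (hn₀ : 4 * m = n₀ + 1) {r : ℕ} (hr : r + 2 ≤ 2 * m)
  (J : ℕ) {nn : ℕ} (hnn : 4 * (2 ^ J * m) = nn + 1) (hK : 2 * (2 ^ J * m) ≤ n) (hN' : ∀ ν, nn + 1 ≤ fine n (Msl M lam) ν)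
include hkL hnL hfit hd hz hext h4m hn₀ hr hnn hK hN'

/-- **THE TRANSVERSAL ENERGY NEAR AN EDGE DECAYS (one tube).**  For every field `z` supported in `blockReg S`, transversal vertex `β′` with an
exterior transversal octant along the zone of the ramp starting at `t₀`, and radius `r + 2 ≤ 2m`:
`Σ_{t ∈ plateau} Σ_i Σ_{y : NearVtx r β′ y} ‖(∂_{succAbove i} z)(ins t y)‖² ≤ θ_d^J·((1 + 64(1+2^d)K²·4ℓ²)·Σ_{t∈zone} n²·dirOn(big slice) + 64(1+2^d)K²/n²·Σ_{t∈zone}Σ_j‖1_ΩΔz‖²)`.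
[folklore] -/
theorem near_edge_energy_le [DecidablePred (NearVtx n (Msl M lam) r β')] :
    ∑ t ∈ plateau n M lam kL (nL := nL) t₀, ∑ i : Fin d, ∑ y : Tor (fine n (Msl M lam)),
        (if NearVtx n (Msl M lam) r β' y then ‖(sdiff (fine n M) (n : ℂ) (lam.succAbove i) *ᵥ z) (ins (fine n M) lam t y)‖ ^ 2 else 0)
      ≤ theta d ^ J * ((1 + (64 * (1 + 2 ^ d) * (((2 ^ J * m : ℕ) : ℝ)) ^ 2) * (4 * (1 / ((kL : ℝ) - 1)) ^ 2))
            * ∑ t ∈ zoneL (fine n M) lam (nL := nL) t₀, (n : ℝ) ^ 2 * dirOn (univ : Finset (Fin d → Fin (nn + 1)))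
                (zsl (fine n M) lam z t ∘ chart (fine n (Msl M lam)) (n := nn) (cornerBase n (Msl M lam) β' (2 ^ J * m)))
          + 64 * (1 + 2 ^ d) * (((2 ^ J * m : ℕ) : ℝ)) ^ 2 / (n : ℝ) ^ 2
            * ∑ t ∈ zoneL (fine n M) lam (nL := nL) t₀, ∑ j : Fin d → Fin (nn + 1),
                ‖restrictTo (blockReg n M S) (LapS (fine n M) (n : ℂ) *ᵥ z) (ins (fine n M) lam t (chart (fine n (Msl M lam)) (cornerBase n (Msl M lam) β' (2 ^ J * m)) j))‖ ^ 2) := by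
  have hm : 1 ≤ m := by omega
  have hmK : m ≤ 2 ^ J * m := Nat.le_mul_of_pos_left m (pow_pos (by norm_num) J)
  -- slice by slice: file 14 on the transversal torus, transversal differences act inside the slice
  have hslice : ∀ t, ∑ i : Fin d, ∑ y : Tor (fine n (Msl M lam)),
        (if NearVtx n (Msl M lam) r β' y then ‖(sdiff (fine n M) (n : ℂ) (lam.succAbove i) *ᵥ z) (ins (fine n M) lam t y)‖ ^ 2 else 0)
      ≤ (n : ℝ) ^ 2 * dirOn (univ : Finset (Fin d → Fin (n₀ + 1)))
          (zsl (fine n M) lam z t ∘ chart (fine n (Msl M lam)) (n := n₀) (vtxBase n (Msl M lam) m (2 ^ J * m) β')) := by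
    intro t
    have h := sum_nearVtx_le_dirOn (n := n) (M := Msl M lam) hmK h4m hn₀ hr β' (zsl (fine n M) lam z t)
    simp_rw [sdiff_succAbove_ins]
    exact h
  refine (Finset.sum_le_sum fun t _ => hslice t).trans ?_
  refine (sum_plateau_le_sum_weight hkL hfit t₀ (fun t => mul_nonneg (sq_nonneg _) (dirOn_nonneg _ _))).trans ?_
  exact tube_decay_energy hkL hnL hfit t₀ hd S hz β' σ hext hm hn₀ J hnn hK hN'

end End

end Summit.QuantumFields.BalabanUV.T4Continuum.DirichletTubeEnergy

end
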